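import Literature.AnabelianGeometry.SemiGraphs.TemperedEdgeLikeCommensurable
import Literature.AnabelianGeometry.SemiGraphs.TemperedEdgeLikeCommensurator
import Literature.AnabelianGeometry.SemiGraphs.TemperedCompactInVerticialFinite
import HarnessLib

/-!
# [SemiAnbd] Thm 3.7: commensurable edge-like subgroups are equal — the `hrigid` (EN) binder AT ONE GRAPH
# (φ2 twin of `TemperedEdgeLikeCommensurable`, proof-only)

Mochizuki, *Semi-graphs of anabelioids*, Publ. RIMS **42** (2006), Thm 3.7 (iii)/(iv), pp. 40–41, and §5,
p. 65 [cite: MochizukiSemiAnbd2006, Thm 3.7 (iii)(iv) pp.40–41; §5 p.65].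

PROOF-ONLY companion (cell abc-iut, layer L3, L3-lead α107 «CIV-REBIND-L3», CompactInVerticial half; seat
abc-iut-w6-d120; label [mechanical rebind after p442260/p443103; not a cone member]) of abc-iut-w4-d053's
`TemperedEdgeLikeCommensurable.lean`.  Of its two consumers of the ∀-countable named fact Thm 3.7 (iii)
`CompactInVerticial` (FACT-LIST F-1732, ∀-countable reading refuted at universe `0`,
`ProfiniteSemiGraph.not_compactInVerticial`), the main one already has its per-graph twin
`eq_of_commensurable_of_mem_edgeLikeSubgroupsAt` (`TemperedEdgeLikeCommensurator.lean`); this file supplies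
the twin of the remaining one — the `VN`/`EN`-binder shape `edgeLike_commensurable_rigid` consumed by
abc-iut-w4-d059's arithmetic cores — with abc-iut-w4-d075's per-graph predicate `CompactInVerticialAt 𝒢`
(port rule α4-3, decl suffix `At`), and DISCHARGES it at FINITE graphs (`edgeLike_commensurable_rigid_of_finiteGraph`, via
`compactInVerticialAt_of_finiteGraph`, p431007; print p. 41 "since the semi-graphs `𝔾_j` are all finite"; the
finite form of the main theorem is already abc-iut-L3's `eq_of_commensurable_of_mem_edgeLikeSubgroups_of_finiteGraph`,
`TemperedMaximalCompactFiniteAt.lean`).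
Original untouched; nothing here asserts Thm 3.7 (iii) for an infinite `𝔾`; nothing here takes a side on
[IUTchIII] Cor. 3.12; typed ≠ discharged.
-/

namespace Literature.AnabelianGeometry.SemiGraphs

namespace ProfiniteSemiGraph

universe u

variable {𝒢 : ProfiniteSemiGraph.{u}}

/-- **`hrigid` for edge-like subgroups AT the graph `𝒢`** (φ2 twin of `edgeLike_commensurable_rigid`; the
`EN`-binder shape of abc-iut-w4-d059's cores, `EN := {L | ∃ e, L ∈ edgeLikeSubgroups c e}`): commensurable
members of `EN` are equal — from Thm 3.7 (iii) AT `𝒢` (`eq_of_commensurable_of_mem_edgeLikeSubgroupsAt`).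
[cite: MochizukiSemiAnbd2006, Thm 3.7 (iii)(iv), pp. 40–41; §5, p. 65] -/
theorem edgeLike_commensurable_rigidAt (h : CompactInVerticialAt 𝒢) (h𝒢 : 𝒢.Thm37Hypotheses)
    (hG : 𝒢.graph.IsGraph) (c : TemperedPiChart 𝒢) :
    ∀ L ∈ {L : Subgroup c.G | ∃ e : 𝒢.graph.Edge, L ∈ edgeLikeSubgroups c e},
      ∀ L' ∈ {L : Subgroup c.G | ∃ e : 𝒢.graph.Edge, L ∈ edgeLikeSubgroups c e},
        Subgroup.Commensurable L L' → L = L' := by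
  rintro L ⟨e, hL⟩ L' ⟨e', hL'⟩ hc
  exact eq_of_commensurable_of_mem_edgeLikeSubgroupsAt h h𝒢 hG c hL hL' hc

/-! ### Discharged at FINITE graphs (print p. 41: "the semi-graphs `𝔾_j` are all finite") -/

/-- **`hrigid` for edge-like subgroups at a FINITE graph** (the `EN`-binder shape) — no binder beyond the
hypotheses of Thm 3.7. [cite: MochizukiSemiAnbd2006, Thm 3.7 (iii)(iv), pp. 40–41; §5, p. 65] -/
theorem edgeLike_commensurable_rigid_of_finiteGraph [Finite 𝒢.graph.Vertex] [Finite 𝒢.graph.Edge]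
    (h𝒢 : 𝒢.Thm37Hypotheses) (hG : 𝒢.graph.IsGraph) (c : TemperedPiChart 𝒢) :
    ∀ L ∈ {L : Subgroup c.G | ∃ e : 𝒢.graph.Edge, L ∈ edgeLikeSubgroups c e},
      ∀ L' ∈ {L : Subgroup c.G | ∃ e : 𝒢.graph.Edge, L ∈ edgeLikeSubgroups c e},
        Subgroup.Commensurable L L' → L = L' :=
  edgeLike_commensurable_rigidAt compactInVerticialAt_of_finiteGraph h𝒢 hG c

end ProfiniteSemiGraph

end Literature.AnabelianGeometry.SemiGraphs
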